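import Mathlib.Tactic

set_option linter.dupNamespace false

/-!
# The inert transition game of the unit Kolyvagin system over `K″` — kernel-checked combinatorics
(crux idea `cuspidal-descent-kolyvagin-nonvanishing`, stmt-BirchSwinnertonDyer-19945; memo
`CuspidalDescentK3Inert-g33.md` §4–§5; planner bsd-idea-20 g33, 2026-08-29)

No summit statement, crux or route item is proved in this file; BSD is not proved. This file certifies
ONLY the combinatorial half of THEOREM §5 of the memo. The arithmetic half (that adding an inert
Kolyvagin prime `λ = (ℓ)`, `ℓ ≡ −1 (7)`, of type `ε = χ_D(ℓ)` moves the dimension vector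
`(x₊, y₊, x₋, y₋) = (dim X(n)^±, dim Y(n)^±)` of the residual unit Kolyvagin system by one of the four
rules α/β/γ/δ below, and that every rule is realisable by Čebotarev whenever its «needs» hold) is the
memo's SQUARING LEMMA + Poitou–Tate, on paper.

* `St`, `Move`, `step`, `run`: the game over `ℤ` WITHOUT legality (hits always allowed). Rules: a prime
  of type `+1` acts on the `+` component by α (`x₊ − 1`, "hit") or β (`y₊ + 1`, "miss") and on the `−`
  component by γ (`y₋ − 1`) or δ (`x₋ + 1`); a prime of type `−1` acts on `−` by α/β and on `+` by γ/δ.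
* `run_xm_sub_ym`, `run_xp_sub_yp`: the signed prime count is a difference of potentials;
  `run_yp_ge`, `run_ym_ge`: `y₊` drops only under type-`(−1)` primes, `y₋` only under type `(+1)`.
* `level_ge_two_a`, `level_ge_two_b_sub_one`: THEOREM §5(i) — from the start vector
  `(1 + a, a, b, b)` (LEMMA 0 of the memo: `a = r⁻(D)`, `b = rk₇ Cl(F₂)^{(ω⁵χ_Dχ_{d″})}`), ANY sequence
  of inert primes ending with `Y = 0` and non-negative `X`-dimensions has length `≥ 2a` and `≥ 2b − 1`.
  (Legality only shrinks the set of sequences, so the bound holds a fortiori for the legal game.)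
* `NSt`, `succs`, `reach`: the LEGAL game over `ℕ` (a hit needs the coordinate `≥ 1`), and
  `minLevel_table`: for `a, b ≤ 2` the least level with `Y = 0` is exactly `max (2a) (2b − 1)`
  (`reach (ν−1) = false ∧ reach ν = true`), by `decide`; `stratumC_no_single_prime`: on stratum (C)
  (`a = 1`, `b = 0`) no single inert prime works and the two-prime solutions have opposite types.
-/

namespace Summit.BirchSwinnertonDyer.BirchSwinnertonDyer.Cruxes.EllipticUnitValueSevenOfGZK.CuspidalDescent.InertGame

/-- Dimension vector `(x₊, y₊, x₋, y₋)` over `ℤ` (no legality). -/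
structure St where
  xp : ℤ
  yp : ℤ
  xm : ℤ
  ym : ℤ
  deriving DecidableEq, Repr

/-- An inert Kolyvagin prime: its type and the two hit/miss events (memo §4: α vs β on the component
where `T̄` is `Frob_ℓ`-trivial, γ vs δ on the other component). -/
inductive Move where
  /-- type `χ_D(ℓ) = +1`: `hitX` = rule α on `X⁺` (else β: `y₊+1`), `hitY` = rule γ on `Y⁻` (else δ: `x₋+1`) -/
  | plus (hitX : Bool) (hitY : Bool)
  /-- type `χ_D(ℓ) = −1`: `hitX` = rule α on `X⁻` (else β: `y₋+1`), `hitY` = rule γ on `Y⁺` (else δ: `x₊+1`) -/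
  | minus (hitX : Bool) (hitY : Bool)
  deriving DecidableEq, Repr

/-- One transition (memo §4 table). -/
def step (s : St) : Move → St
  | .plus hx hy =>
      { xp := bif hx then s.xp - 1 else s.xp
        yp := bif hx then s.yp else s.yp + 1
        xm := bif hy then s.xm else s.xm + 1
        ym := bif hy then s.ym - 1 else s.ym }
  | .minus hx hy =>
      { xp := bif hy then s.xp else s.xp + 1
        yp := bif hy then s.yp - 1 else s.yp
        xm := bif hx then s.xm - 1 else s.xm
        ym := bif hx then s.ym else s.ym + 1 }

/-- Apply a sequence of inert primes. -/
def run (s : St) : List Move → St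
  | [] => s
  | m :: ms => run (step s m) ms

/-- Number of type-`(+1)` primes. -/
def numPlus : List Move → ℕ
  | [] => 0
  | .plus _ _ :: ms => numPlus ms + 1
  | .minus _ _ :: ms => numPlus ms

/-- Number of type-`(−1)` primes. -/
def numMinus : List Move → ℕ
  | [] => 0
  | .plus _ _ :: ms => numMinus ms
  | .minus _ _ :: ms => numMinus ms + 1

theorem length_eq_numPlus_add_numMinus (ms : List Move) :
    ms.length = numPlus ms + numMinus ms := by
  induction ms with
  | nil => simp [numPlus, numMinus]
  | cons m ms ih => cases m <;> simp [numPlus, numMinus, ih] <;> omega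

/-- Each type-`(+1)` prime raises `x₋ − y₋` by one, each type-`(−1)` prime lowers it by one. -/
theorem run_xm_sub_ym (s : St) (ms : List Move) :
    (run s ms).xm - (run s ms).ym = (s.xm - s.ym) + numPlus ms - numMinus ms := by
  induction ms generalizing s with
  | nil => simp [run, numPlus, numMinus]
  | cons m ms ih =>
    cases m with
    | plus hx hy =>
        simp only [run, numPlus, numMinus, ih]
        cases hx <;> cases hy <;> simp [step] <;> omega
    | minus hx hy =>
        simp only [run, numPlus, numMinus, ih]
        cases hx <;> cases hy <;> simp [step] <;> omega

/-- Each type-`(−1)` prime raises `x₊ − y₊` by one, each type-`(+1)` prime lowers it by one. -/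
theorem run_xp_sub_yp (s : St) (ms : List Move) :
    (run s ms).xp - (run s ms).yp = (s.xp - s.yp) + numMinus ms - numPlus ms := by
  induction ms generalizing s with
  | nil => simp [run, numPlus, numMinus]
  | cons m ms ih =>
    cases m with
    | plus hx hy =>
        simp only [run, numPlus, numMinus, ih]
        cases hx <;> cases hy <;> simp [step] <;> omega
    | minus hx hy =>
        simp only [run, numPlus, numMinus, ih]
        cases hx <;> cases hy <;> simp [step] <;> omega

/-- `y₊` decreases only under type-`(−1)` primes (rule γ), by at most one each. -/
theorem run_yp_ge (s : St) (ms : List Move) :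
    s.yp - numMinus ms ≤ (run s ms).yp := by
  induction ms generalizing s with
  | nil => simp [run, numMinus]
  | cons m ms ih =>
    cases m with
    | plus hx hy =>
        simp only [run, numMinus]
        refine le_trans ?_ (ih _)
        cases hx <;> cases hy <;> simp [step]
    | minus hx hy =>
        simp only [run, numMinus]
        refine le_trans ?_ (ih _)
        cases hx <;> cases hy <;> simp [step] <;> omega

/-- `y₋` decreases only under type-`(+1)` primes (rule γ), by at most one each. -/
theorem run_ym_ge (s : St) (ms : List Move) :
    s.ym - numPlus ms ≤ (run s ms).ym := by
  induction ms generalizing s with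
  | nil => simp [run, numPlus]
  | cons m ms ih =>
    cases m with
    | plus hx hy =>
        simp only [run, numPlus]
        refine le_trans ?_ (ih _)
        cases hx <;> cases hy <;> simp [step] <;> omega
    | minus hx hy =>
        simp only [run, numPlus]
        refine le_trans ?_ (ih _)
        cases hx <;> cases hy <;> simp [step]

/-- The start vector of LEMMA 0: `(dim X(1)⁺, dim Y(1)⁺, dim X(1)⁻, dim Y(1)⁻) = (1 + a, a, b, b)`. -/
def start (a b : ℕ) : St := ⟨1 + a, a, b, b⟩

@[simp] theorem start_xp (a b : ℕ) : (start a b).xp = 1 + a := rfl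
@[simp] theorem start_yp (a b : ℕ) : (start a b).yp = a := rfl
@[simp] theorem start_xm (a b : ℕ) : (start a b).xm = b := rfl
@[simp] theorem start_ym (a b : ℕ) : (start a b).ym = b := rfl

/-- **THEOREM §5(i), first bound.** Any sequence of inert Kolyvagin primes that kills the dual Selmer
group (`y₊ = y₋ = 0` at the end) with `x₋ ≥ 0` at the end uses at least `2a` primes. -/
theorem level_ge_two_a (a b : ℕ) (ms : List Move)
    (hyp : (run (start a b) ms).yp = 0) (hym : (run (start a b) ms).ym = 0)
    (hxm : 0 ≤ (run (start a b) ms).xm) : 2 * a ≤ ms.length := by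
  have h1 := run_xm_sub_ym (start a b) ms
  have h2 := run_yp_ge (start a b) ms
  have h3 := length_eq_numPlus_add_numMinus ms
  simp only [start_xm, start_ym, start_yp] at h1 h2
  omega

/-- **THEOREM §5(i), second bound.** Any such sequence with `x₊ ≥ 0` at the end uses at least `2b − 1`
primes (`2b ≤ ν + 1`). -/
theorem level_ge_two_b_sub_one (a b : ℕ) (ms : List Move)
    (hyp : (run (start a b) ms).yp = 0) (hym : (run (start a b) ms).ym = 0)
    (hxp : 0 ≤ (run (start a b) ms).xp) : 2 * b ≤ ms.length + 1 := by
  have h1 := run_xp_sub_yp (start a b) ms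
  have h2 := run_ym_ge (start a b) ms
  have h3 := length_eq_numPlus_add_numMinus ms
  simp only [start_xp, start_yp, start_ym] at h1 h2
  omega

/-- The core-rank invariant `(x₊ − y₊) + (x₋ − y₋)` is conserved (it equals `1` from `start`). -/
theorem run_invariant (s : St) (ms : List Move) :
    ((run s ms).xp - (run s ms).yp) + ((run s ms).xm - (run s ms).ym)
      = (s.xp - s.yp) + (s.xm - s.ym) := by
  have h1 := run_xm_sub_ym s ms
  have h2 := run_xp_sub_yp s ms
  omega

/-! ## The legal game over `ℕ` (hits need the coordinate `≥ 1`), decided for small `a, b` -/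

/-- Dimension vector over `ℕ`. -/
structure NSt where
  xp : ℕ
  yp : ℕ
  xm : ℕ
  ym : ℕ
  deriving DecidableEq, Repr

/-- Legal successors: all inert primes of both types with all realisable hit/miss patterns
(memo §4: α needs `x ≥ 1`, γ needs `y ≥ 1`; β, δ always available). -/
def succs (s : NSt) : List NSt :=
  let plusX : List (ℕ × ℕ) := (if 1 ≤ s.xp then [(s.xp - 1, s.yp)] else []) ++ [(s.xp, s.yp + 1)]
  let plusY : List (ℕ × ℕ) := (if 1 ≤ s.ym then [(s.xm, s.ym - 1)] else []) ++ [(s.xm + 1, s.ym)]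
  let minusX : List (ℕ × ℕ) := (if 1 ≤ s.xm then [(s.xm - 1, s.ym)] else []) ++ [(s.xm, s.ym + 1)]
  let minusY : List (ℕ × ℕ) := (if 1 ≤ s.yp then [(s.xp, s.yp - 1)] else []) ++ [(s.xp + 1, s.yp)]
  (plusX.flatMap fun p => plusY.map fun q => (⟨p.1, p.2, q.1, q.2⟩ : NSt)) ++
  (minusX.flatMap fun q => minusY.map fun p => (⟨p.1, p.2, q.1, q.2⟩ : NSt))

/-- `Y(n) = 0`, i.e. `λ(n) = 0` (a core vertex). -/
def goal (s : NSt) : Bool := s.yp == 0 && s.ym == 0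

/-- `reach ν s`: a core vertex is reachable from `s` with at most `ν` further inert primes. -/
def reach : ℕ → NSt → Bool
  | 0, s => goal s
  | n + 1, s => goal s || (succs s).any (reach n)

/-- LEMMA 0 start vector over `ℕ`. -/
def nstart (a b : ℕ) : NSt := ⟨1 + a, a, b, b⟩

/-- **Stratum (C)** (`a = r⁻(D) = 1`, `b = 0`, admissible `d″`): no single inert Kolyvagin prime
reaches a core vertex, two do; and the legal successors of `(2,1,0,0)` are exactly the four vectors of
the memo (§5, Corollary (strata)). -/
theorem stratumC_no_single_prime :
    reach 0 (nstart 1 0) = false ∧ reach 1 (nstart 1 0) = false ∧ reach 2 (nstart 1 0) = true ∧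
    succs (nstart 1 0) = [⟨1, 1, 1, 0⟩, ⟨2, 2, 1, 0⟩, ⟨2, 0, 0, 1⟩, ⟨3, 1, 0, 1⟩] := by
  decide

/-- On (C) the two-prime solutions have OPPOSITE types: from the type-`(+1)` successor `(1,1,1,0)` and
from the type-`(−1)` successor `(2,0,0,1)` one more prime suffices, from the other two it does not. -/
theorem stratumC_pairs :
    reach 1 ⟨1, 1, 1, 0⟩ = true ∧ reach 1 ⟨2, 0, 0, 1⟩ = true ∧
    reach 1 ⟨2, 2, 1, 0⟩ = false ∧ reach 1 ⟨3, 1, 0, 1⟩ = false := by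
  decide

/-- **Table of minimal inert levels**, `a, b ≤ 2`: `ν_min(a,b) = max (2a) (2b − 1)`, i.e.
`(0,0) ↦ 0`, `(1,0) ↦ 2`, `(2,0) ↦ 4`, `(0,1) ↦ 1`, `(1,1) ↦ 2`, `(2,1) ↦ 4`, `(0,2) ↦ 3`, `(1,2) ↦ 3`,
`(2,2) ↦ 4` — each as `reach (ν − 1) = false ∧ reach ν = true`. -/
theorem minLevel_table :
    reach 0 (nstart 0 0) = true ∧
    (reach 1 (nstart 1 0) = false ∧ reach 2 (nstart 1 0) = true) ∧
    (reach 3 (nstart 2 0) = false ∧ reach 4 (nstart 2 0) = true) ∧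
    (reach 0 (nstart 0 1) = false ∧ reach 1 (nstart 0 1) = true) ∧
    (reach 1 (nstart 1 1) = false ∧ reach 2 (nstart 1 1) = true) ∧
    (reach 3 (nstart 2 1) = false ∧ reach 4 (nstart 2 1) = true) ∧
    (reach 2 (nstart 0 2) = false ∧ reach 3 (nstart 0 2) = true) ∧
    (reach 2 (nstart 1 2) = false ∧ reach 3 (nstart 1 2) = true) ∧
    (reach 3 (nstart 2 2) = false ∧ reach 4 (nstart 2 2) = true) := by
  decide

end Summit.BirchSwinnertonDyer.BirchSwinnertonDyer.Cruxes.EllipticUnitValueSevenOfGZK.CuspidalDescent.InertGame
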